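import Summits.BirchSwinnertonDyer.BirchSwinnertonDyer.Theorems.SylvesterTwoHeegnerIndexCMDataPairRecipe
import Literature.NumberTheory.EllipticCurves.RingClassFieldInertiaGenerator
import HarnessLib

/-!
# (F) of leaf (L1), crux `UpperOffV0HSYPlus` (stmt-BirchSwinnertonDyer-19804): PREPARATIONS for the AT-LEVEL FLIP
# at the two-prime level `9pℓℓ'` — commuting derivative operators, a `γ`-wise congruence pushed through `D_{ℓ'}`,
# and #17b's inertia package at the level written `9 * p * (ℓ * ℓ')`

Skeleton of record VARIANT M (`Cruxes/UpperOffV0HSYPlus/Lines/coupled_variantM.lean` 406ca288e244d392);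
card v28; planner D475/D486.  Sibling of `…CMFlipLevelPrimePrep` (single prime); consumed by `…CMFlipLevelPair`:

* `pointGalHom_derivOp_comm` — commuting automorphisms commute with each other's `D` (Gross §3: `G_n = ∏ G_ℓ` in
  the abelian `Gal(K_n/K)`; used with x11b3 `isMulCommutative_ringClassGal'` for `σ_ℓ`, `σ_{ℓ'}`);
* `map_smul_derivOp_eq_of_forall` — a `γ`-wise reduction congruence for `(y, y₀)` gives the congruence for
  `(D_{σ'} y, D_{σ'} y₀)` (Gross, proof of Prop. 6.2 (2): "for any σ ∈ 𝒢_n we conjugate this congruence";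
  abstract level field, one `DecidableEq`, as in #F1a's `smul_embPoints_sub_eq_zsmul`);
* `inertia_package_pair` — k-ty1 #17b §3–§4 at the level `9 * p * (ℓ * ℓ')` (`m = 9pℓ'`; the tree's `ℓ * m`
  rewritten on a closed statement): `τ₀ ↦ σ_ℓ`, `I_𝔓` through `⟨τ₀⟩` on `N`-fixed points, and `I_𝔓, Frob_𝔓`
  inside the `K[9p]`-fixer `N'` (they fix `emb K[9pℓ'] ⊇ emb K[9p]`).

HONEST FRAMING: theorems only (no definition, no named fact, no instance, no notation); assembly of PROVED tree
theorems; nothing about Sel/Ш/BSD; no stub closed; `--supports stmt-BirchSwinnertonDyer-19804 --as helper`.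
References: [GrossLMS1991] §3 (p. 239), Prop. 6.2 (2) proof (p. 245); [McCallumLMS1991] §4 (p. 304).
Tree search: `lean search 'derivOp_comm|inertia_package_pair'` → nothing before this file; presearch n/a (assembly).
-/

set_option linter.dupNamespace false -- Summits modules are `Summit.<Summit>.<Problem>…` by design
set_option autoImplicit false

noncomputable section

open scoped Classical Pointwise

namespace Summit.BirchSwinnertonDyer.BirchSwinnertonDyer.Theorems.SylvesterTwoCMFlip

open WeierstrassCurve Field NumberField IsDedekindDomain Finset
open Literature.NumberTheory.EllipticCurves Literature.NumberTheory.GaloisRepresentations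
  Literature.NumberTheory.EllipticCurves.ModularForms
  Literature.NumberTheory.EllipticCurves.HuShuYin2019
  Literature.NumberTheory.EllipticCurves.KolyvaginCocycle
  Summit.BirchSwinnertonDyer.BirchSwinnertonDyer.Theorems.SylvesterTwoCMData
  Summit.BirchSwinnertonDyer.Rank1Residual.X11b
  Summit.BirchSwinnertonDyer.Rank1Residual.X11b.RingClassTower

variable {K : Type} [Field K] [NumberField K]

/-- **Commuting automorphisms commute with each other's derivative operator**: if `σ σ' = σ' σ` then
`σ (D_{σ'} z) = D_{σ'} (σ z)` for `D_{σ'} = Σ_{k ≤ ℓ'} k σ'^k` (`KolyvaginOperator.derivOp`; Gross 1991 §3: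
`G_n ≃ ∏ G_ℓ` inside the ABELIAN `Gal(K_n/K)`, so `D_ℓ`, `D_{ℓ'}`, `σ_ℓ` commute). [cite: GrossLMS1991, §3 (p. 239: G_n = ∏ G_ℓ, D_n = ∏ D_ℓ)] -/
theorem pointGalHom_derivOp_comm (W : WeierstrassCurve ℚ) {L : Type} [Field L] [CharZero L]
    [DecidableEq L] {σ σ' : L ≃ₐ[ℚ] L} (hc : Commute σ σ') (ℓ' : ℕ) (z : (W.baseChange L).toAffine.Point) :
    pointGalHom W L σ (KolyvaginOperator.derivOp (pointGalHom W L) σ' ℓ' z) =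
      KolyvaginOperator.derivOp (pointGalHom W L) σ' ℓ' (pointGalHom W L σ z) := by
  unfold KolyvaginOperator.derivOp
  rw [map_sum]
  refine Finset.sum_congr rfl fun k _ ↦ ?_
  rw [map_nsmul]
  congr 1
  change (pointGalHom W L σ * pointGalHom W L (σ' ^ k)) z = (pointGalHom W L (σ' ^ k) * pointGalHom W L σ) z
  rw [← map_mul, ← map_mul, (hc.pow_right k).eq]

/-- **A `γ`-wise congruence passes through a derivative operator** (Gross 1991, proof of Prop. 6.2 (2):
*"for any `σ ∈ 𝒢_n` we conjugate this congruence"*; the tree's `KolyvaginEuler.map_smul_kolyvaginPoint_eq_of_forall`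
in the rows' currency): for additive `red`, `φ` and an embedding `ιL` of `W(L)` into a `Γ`-module `X`, if
`red (g • ιL (σ'^k y)) = φ (red (g • ιL (σ'^k y₀)))` for all `k`, then
`red (g • ιL (D_{σ'} y)) = φ (red (g • ιL (D_{σ'} y₀)))` (abstract level field `L`: one `DecidableEq`).
[cite: GrossLMS1991, Prop. 6.2 (2) (proof, p. 245)] -/
theorem map_smul_derivOp_eq_of_forall (W : WeierstrassCurve ℚ) {L : Type} [Field L] [CharZero L]
    {Γ X B : Type*} [Group Γ] [AddCommGroup X] [DistribMulAction Γ X] [AddCommGroup B]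
    (ιL : (W.baseChange L).toAffine.Point →+ X) (red : X →+ B) (φ : B →+ B) (g : Γ)
    (σ' : L ≃ₐ[ℚ] L) (ℓ' : ℕ) {y y₀ : (W.baseChange L).toAffine.Point}
    (h : ∀ k : ℕ, red (g • ιL (pointGalHom W L (σ' ^ k) y)) = φ (red (g • ιL (pointGalHom W L (σ' ^ k) y₀)))) :
    red (g • ιL (KolyvaginOperator.derivOp (pointGalHom W L) σ' ℓ' y)) =
      φ (red (g • ιL (KolyvaginOperator.derivOp (pointGalHom W L) σ' ℓ' y₀))) := by
  unfold KolyvaginOperator.derivOp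
  simp only [map_sum, Finset.smul_sum, map_nsmul, smul_comm g (_ : ℕ)]
  exact Finset.sum_congr rfl fun k _ ↦ by rw [h k]

/-- **#17b's inertia package at the level written `9 * p * (ℓ * ℓ')`** (the tree states it at `ℓ * m`; here
`m = 9pℓ'`): `τ₀ ∈ I_𝔓` restricting to the generator `σ_ℓ` of `Gal(K[9pℓℓ']/K[9pℓ'])`, `I_𝔓` acting on `N`-fixed
points through `⟨τ₀⟩`, and `I_𝔓, Frob_𝔓` inside the `K[9p]`-fixer `N'` (they fix `emb K[9pℓ'] ⊇ emb K[9p]`).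
[cite: GrossLMS1991, §3 (p. 239–240)] [cite: McCallumLMS1991, §4 (p. 304)] -/
theorem inertia_package_pair (hK : IsImaginaryQuadratic K) (ι : K →+* ℂ) {p ℓ ℓ' : ℕ} (hfℓ' : 9 * p * ℓ' ≠ 0)
    (hℓ : ℓ.Prime) (hℓℓ' : ¬ ℓ ∣ 9 * p * ℓ') {v : HeightOneSpectrum (𝓞 K)} (hv : (ℓ : 𝓞 K) ∈ v.asIdeal)
    (hℓP : (Ideal.span {(ℓ : 𝓞 K)}).IsPrime)
    (emb : ringClassField K ι (9 * p * (ℓ * ℓ')) →+* AlgebraicClosure K)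
    (hemb : ∀ k : K, emb (algebraMap K (ringClassField K ι (9 * p * (ℓ * ℓ'))) k) = algebraMap K (AlgebraicClosure K) k)
    {𝔓 : Ideal (absIntegers (𝓞 K) K)} (h𝔓 : 𝔓 ∈ v.primesAbove)
    {σ : ringClassField K ι (9 * p * (ℓ * ℓ')) ≃ₐ[ℚ] ringClassField K ι (9 * p * (ℓ * ℓ'))}
    (hσ : Subgroup.zpowers σ = ringClassGalOver ι (9 * p * (ℓ * ℓ')) (9 * p * ℓ'))
    (N : Subgroup (absoluteGaloisGroup K))
    (hN : ∀ g : absoluteGaloisGroup K, g ∈ N ↔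
      ∀ x : ringClassField K ι (9 * p * (ℓ * ℓ')), (show AlgebraicClosure K ≃ₐ[K] AlgebraicClosure K from g) (emb x) = emb x)
    (N' : Subgroup (absoluteGaloisGroup K))
    (hN' : ∀ g : absoluteGaloisGroup K, g ∈ N' ↔
      ∀ x ∈ {x : ringClassField K ι (9 * p * (ℓ * ℓ')) | (x : ℂ) ∈ ringClassField K ι (9 * p)},
        (show AlgebraicClosure K ≃ₐ[K] AlgebraicClosure K from g) (emb x) = emb x)
    (X : Type) [MulAction (absoluteGaloisGroup K) X] :
    (∃ τ₀ ∈ 𝔓.inertia (absoluteGaloisGroup K),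
      (∀ x : ringClassField K ι (9 * p * (ℓ * ℓ')), (show AlgebraicClosure K ≃ₐ[K] AlgebraicClosure K from τ₀) (emb x) = emb (σ x)) ∧
      ∀ τ ∈ 𝔓.inertia (absoluteGaloisGroup K), ∃ i : ℕ,
        (τ₀ ^ i)⁻¹ * τ ∈ N ∧ ∀ Q : X, (∀ h ∈ N, h • Q = Q) → τ • Q = (τ₀ ^ i) • Q) ∧
    (∀ τ ∈ 𝔓.inertia (absoluteGaloisGroup K), τ ∈ N') ∧
    (∀ F : absoluteGaloisGroup K, IsArithFrobAt (𝓞 K) F 𝔓 → F ∈ N') := by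
  have hp0 : p ≠ 0 := fun h ↦ hfℓ' (by rw [h]; ring)
  have hℓ'0 : ℓ' ≠ 0 := fun h ↦ hfℓ' (by rw [h]; ring)
  have hK9 : ringClassField K ι (9 * p) ≤ ringClassField K ι (9 * p * ℓ') := ringClassField_nine_mul_le hK ι hp0 hℓ'0
  suffices H : ∀ n : ℕ, ℓ * (9 * p * ℓ') = n →
      ∀ (emb : ringClassField K ι n →+* AlgebraicClosure K)
        (_ : ∀ k : K, emb (algebraMap K (ringClassField K ι n) k) = algebraMap K (AlgebraicClosure K) k)
        (σ : ringClassField K ι n ≃ₐ[ℚ] ringClassField K ι n)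
        (_ : Subgroup.zpowers σ = ringClassGalOver ι n (9 * p * ℓ'))
        (N : Subgroup (absoluteGaloisGroup K))
        (_ : ∀ g : absoluteGaloisGroup K, g ∈ N ↔
          ∀ x : ringClassField K ι n, (show AlgebraicClosure K ≃ₐ[K] AlgebraicClosure K from g) (emb x) = emb x)
        (N'' : Subgroup (absoluteGaloisGroup K))
        (_ : ∀ g : absoluteGaloisGroup K, g ∈ N'' ↔
          ∀ x : ringClassField K ι n, (x : ℂ) ∈ ringClassField K ι (9 * p * ℓ') →
            (show AlgebraicClosure K ≃ₐ[K] AlgebraicClosure K from g) (emb x) = emb x),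
        (∃ τ₀ ∈ 𝔓.inertia (absoluteGaloisGroup K),
          (∀ x : ringClassField K ι n,
            (show AlgebraicClosure K ≃ₐ[K] AlgebraicClosure K from τ₀) (emb x) = emb (σ x)) ∧
          ∀ τ ∈ 𝔓.inertia (absoluteGaloisGroup K), ∃ i : ℕ,
            (τ₀ ^ i)⁻¹ * τ ∈ N ∧ ∀ Q : X, (∀ h ∈ N, h • Q = Q) → τ • Q = (τ₀ ^ i) • Q) ∧
        (∀ τ ∈ 𝔓.inertia (absoluteGaloisGroup K), τ ∈ N'') ∧
        (∀ F : absoluteGaloisGroup K, IsArithFrobAt (𝓞 K) F 𝔓 → F ∈ N'') by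
    obtain ⟨N'', hN''⟩ := exists_subgroup_mem_iff_forall emb
      {x : ringClassField K ι (9 * p * (ℓ * ℓ')) | (x : ℂ) ∈ ringClassField K ι (9 * p * ℓ')}
    have hle : N'' ≤ N' := fun g hg ↦ (hN' g).mpr fun x hx ↦ (hN'' g).mp hg x (hK9 hx)
    obtain ⟨h1, h2, h3⟩ := H _ (by ring) emb hemb σ hσ N hN N'' (fun g ↦ (hN'' g).trans (by simp only [Set.mem_setOf_eq]))
    exact ⟨h1, fun τ hτ ↦ hle (h2 τ hτ), fun F hF ↦ hle (h3 F hF)⟩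
  intro n hn emb hemb σ hσ N hN N'' hN''
  subst hn
  exact ⟨exists_mem_inertia_generator_and_forall_smul_eq_pow_smul hK ι hℓ hfℓ' hℓℓ' hv hℓP emb hemb h𝔓 hσ
      N hN (X := X),
    mem_of_mem_inertia_and_mem_of_isArithFrobAt hK ι hℓ hfℓ' hℓℓ' hv hℓP emb hemb h𝔓 N'' hN''⟩

end Summit.BirchSwinnertonDyer.BirchSwinnertonDyer.Theorems.SylvesterTwoCMFlip

end
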